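import Literature.MathematicalPhysics.QuantumFieldTheory.Balaban1983to89.T4ExpWindowSmallField
import Summits.QuantumFields.YangMills.Theorems.BalabanUVNodesN21SlotTestAtRecord
import Mathlib.Analysis.SpecialFunctions.Trigonometric.Sinc
import Mathlib.Analysis.SpecialFunctions.Trigonometric.Bounds
import Mathlib.Analysis.SpecialFunctions.Integrals.Basic
import HarnessLib

/-!
# Route `UnitScaleTilt`, crux stmt-QuantumFields-20520 `FluctuationComparisonRegPrIntL`, PATH-B organ (covariant organ of record, RULING №56),
# row D0, letter (χ-bdd∕Lip∣MW) of ✓p827906 `…OrganTangentD0ChartLettersWhitened` — **THE HAAR FACTOR IS BOUNDED AND LIPSCHITZ ALONG (Dwhite)**: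
# the INHABITATION CERTIFICATE of LEAD w3 g28 RULING №57 (i) «`χ(V,z) = Π_e (σ∕σ₀)((K_V^{−1∕2}z)_e)`, z-dependent (extensive) modulus allowed».
# For `SU(2)` print gives the exponential-chart Haar density explicitly, [Balaban1985UV3] p.260 L25–31: «`σ(A) = (1∕2π²)(sin|A|∕|A|)²` … an analytic,
# positive, even function of A … invariant with respect to the adjoint representation» (tree: lit ✓`T4CubeChartExp.expCubeWeight v = (2π²)⁻¹ sinc²‖toE v‖`),
# and (20)–(21) p.261 exponentiate `σ∕σ₀` INTO the action — print has no separate Jacobian letter.  Here: `(σ∕σ₀)(v) = sinc²‖v‖ ∈ [0,1]` is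
# `1`-Lipschitz in the Euclidean norm (`|sinc x − sinc y| ≤ |x − y|∕2`, proved from `sinc x = ∫₀¹ cos(tx) dt`), so the product over any finite set
# `S` of fine bonds is bounded by `1` and moves by at most `√3·Σ_{e∈S} ‖W′ e − W e‖_∞` — with (Dwhite)'s `‖Wh V′ z e − Wh V z e‖ ≤ kW e·‖u‖` this is
# (χ-Lip) with `Cχ := 1`, `Kχ := √3·Σ_{e∈S} kW e` (extensive in `#S`, harmless: REG′ is qualitative — RULING №57).

Cell `ym3-torus`, WIDTH COPY «width 19» of ★p1 (seat `ym3-torus-px19`, gen 23); `--supports stmt-QuantumFields-20520 --as helper`; count-neutral;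
def-free.  INHABITATION (★★OWNER RULING №100): LAW-FREE — `W e = Wh V z e`, `W′ e = Wh V′ z e` (the whitened fibre coordinates of (L50b) at the two
ends of a coarse one-bond move; `χ V z = Π_{e∈S} sinc²‖toE (Wh V z e)‖` is (Jfac)'s `χ` up to the z-free constant `(2π²)^{−#S}` absorbed in `cJ`);
no fibre law, no score, no cross-law object.

WHAT THIS FILE PROVES (sorry-free).
* §1 ★`sinc_eq_integral_cos` (`sinc x = ∫ t in 0..1, cos (t·x)`), ★★`abs_sinc_sub_sinc_le` (`|sinc x − sinc y| ≤ |x − y|∕2`, Mathlib's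
  ✓`Real.abs_cos_sub_cos_le` under the integral), ★`abs_sinc_sq_sub_sinc_sq_le` (`|sinc²x − sinc²y| ≤ |x − y|`), `sinc_sq_mem_Icc` (`sinc² ∈ [0,1]`).
* §2 telescoping `|Π a − Π b| ≤ Σ |a i − b i|` for factors in `[−1, 1]` = the tree's ✓`N21SlotTestAtRecord.abs_prod_sub_prod_le_sum_abs` (reused).
* §3 (`‖toE v‖ ≤ √3·‖v‖_∞` from lit ✓`norm_toE_le_of_mem_cube`) ★★`haarFactor_mem_Icc` (`Π_{e∈S} sinc²‖toE (W e)‖ ∈ [0,1]`, so `Cχ = 1`);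
  ★★★`haarFactor_lip_of_dwhite` — (Dwhite)-shape increments `∀ e ∈ S, ‖W′ e − W e‖ ≤ kW e·c` ⟹
  `|Π_{e∈S} sinc²‖toE (W′ e)‖ − Π_{e∈S} sinc²‖toE (W e)‖| ≤ √3·(Σ_{e∈S} kW e)·c` — (χ-Lip)'s `Kχ := √3·Σ kW` by name.

HONEST SCOPE.  Elementary real analysis (sinc via its cosine integral) + a telescoping sum; nothing of Bałaban's operators is constructed; (Dwhite)
itself, (Dmin), the D0 chart object, rows v0.1–v0.4 UNDISCHARGED; the five registered stubs, 20520, 19936, 19200, `YM3TorusSU2` NOT proved; no summit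
is proved by a helper.  R3 = SU(2) YM₃ on T³ — NOT d = 4, NOT infinite volume, NOT a mass gap, NOT Clay; the Yang–Mills mass gap is NOT proved.

References: T. Bałaban, CMP **102** (1985) 255–275 [Balaban1985UV3] (p.260 L25–31, (20)–(21) p.261); CMP **109** (1987) 249–301 [Balaban1987RG1]
((2.10) p.266 «the factors σ₀ are included into the normalization factor»).
-/

noncomputable section

open Real MeasureTheory intervalIntegral Set Finset
open Literature.MathematicalPhysics.QuantumFieldTheory.Balaban1983to89
open T4CubeChartExp (toE norm_toE_sq)
open T4CubePoincare (mem_cube_iff)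
open T4ExpWindowSmallField (norm_toE_le_of_mem_cube)
open Summit.QuantumFields.YangMills.Theorems.N21SlotTestAtRecord (abs_prod_sub_prod_le_sum_abs)

namespace Summit.QuantumFields.YangMills.Theorems.OrganTangentHaarFactorLipOfDwhite

/-! ## §1 `sinc` is `½`-Lipschitz, `sinc²` is `1`-Lipschitz with values in `[0,1]` -/

/-- ★ **`sinc` AS A COSINE AVERAGE**: `sinc x = ∫₀¹ cos(t·x) dt` (for `x ≠ 0` by the substitution `u = t·x` and `∫ cos = sin`; at `x = 0` both
sides are `1`). [folklore] -/
theorem sinc_eq_integral_cos (x : ℝ) : sinc x = ∫ t in (0 : ℝ)..1, Real.cos (t * x) := by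
  by_cases hx : x = 0
  · subst hx; simp
  · rw [sinc_of_ne_zero hx, intervalIntegral.integral_comp_mul_right (fun u => Real.cos u) hx, integral_cos]
    simp [div_eq_inv_mul]

/-- ★★ **`sinc` IS `½`-LIPSCHITZ**: `|sinc x − sinc y| ≤ |x − y|∕2` (`|cos(tx) − cos(ty)| ≤ t·|x − y|` under `∫₀¹`, Mathlib ✓`abs_cos_sub_cos_le`).
[folklore] -/
theorem abs_sinc_sub_sinc_le (x y : ℝ) : |sinc x - sinc y| ≤ |x - y| / 2 := by
  have hi : ∀ z : ℝ, IntervalIntegrable (fun t : ℝ => Real.cos (t * z)) volume (0 : ℝ) 1 :=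
    fun z => Continuous.intervalIntegrable (by fun_prop) _ _
  rw [sinc_eq_integral_cos, sinc_eq_integral_cos, ← intervalIntegral.integral_sub (hi x) (hi y)]
  calc |∫ t in (0 : ℝ)..1, (Real.cos (t * x) - Real.cos (t * y))|
      ≤ ∫ t in (0 : ℝ)..1, |Real.cos (t * x) - Real.cos (t * y)| :=
        intervalIntegral.abs_integral_le_integral_abs zero_le_one
    _ ≤ ∫ t in (0 : ℝ)..1, t * |x - y| := by
        refine intervalIntegral.integral_mono_on zero_le_one ((hi x).sub (hi y)).abs
          (Continuous.intervalIntegrable (by fun_prop) _ _) fun t ht => ?_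
        calc |Real.cos (t * x) - Real.cos (t * y)| ≤ |t * x - t * y| := Real.abs_cos_sub_cos_le _ _
          _ = t * |x - y| := by rw [← mul_sub, abs_mul, abs_of_nonneg ht.1]
    _ = |x - y| / 2 := by
        rw [intervalIntegral.integral_mul_const, integral_id]; ring

/-- `sinc² ∈ [0, 1]`. [folklore] -/
theorem sinc_sq_mem_Icc (x : ℝ) : sinc x ^ 2 ∈ Set.Icc (0 : ℝ) 1 := by
  refine ⟨sq_nonneg _, ?_⟩
  have h := abs_sinc_le_one x
  calc sinc x ^ 2 = |sinc x| ^ 2 := (sq_abs _).symm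
    _ ≤ 1 ^ 2 := pow_le_pow_left₀ (abs_nonneg _) h 2
    _ = 1 := one_pow 2

/-- ★ **`sinc²` IS `1`-LIPSCHITZ**: `|sinc² x − sinc² y| ≤ |x − y|` (`= |sinc x − sinc y|·|sinc x + sinc y| ≤ (|x−y|∕2)·2`). [folklore] -/
theorem abs_sinc_sq_sub_sinc_sq_le (x y : ℝ) : |sinc x ^ 2 - sinc y ^ 2| ≤ |x - y| := by
  have h1 := abs_sinc_sub_sinc_le x y
  have h2 : |sinc x + sinc y| ≤ 2 := by
    calc |sinc x + sinc y| ≤ |sinc x| + |sinc y| := abs_add_le _ _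
      _ ≤ 1 + 1 := add_le_add (abs_sinc_le_one x) (abs_sinc_le_one y)
      _ = 2 := by norm_num
  rw [sq_sub_sq, abs_mul]
  calc |sinc x + sinc y| * |sinc x - sinc y| ≤ 2 * (|x - y| / 2) :=
        mul_le_mul h2 h1 (abs_nonneg _) (by norm_num)
    _ = |x - y| := by ring

/-! ## §2 Telescoping: `|Π a − Π b| ≤ Σ |a i − b i|` for factors in `[−1, 1]` is the tree's
✓`N21SlotTestAtRecord.abs_prod_sub_prod_le_sum_abs` (reused by name, not restated). -/

/-! ## §3 The Haar factor along (Dwhite) -/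

/-- `toE` is additive: `toE (v − v′) = toE v − toE v′`. [folklore] -/
theorem toE_sub (v v' : Fin 3 → ℝ) : toE (v - v') = toE v - toE v' := rfl

/-- ★★ **THE HAAR FACTOR LIES IN `[0,1]`** (`Cχ = 1`): `Π_{e∈S} sinc²‖toE (W e)‖ ∈ [0,1]`. [cite: Balaban1985UV3, p.260 L25-31] -/
theorem haarFactor_mem_Icc {β : Type*} (S : Finset β) (W : β → Fin 3 → ℝ) :
    (∏ e ∈ S, sinc ‖toE (W e)‖ ^ 2) ∈ Set.Icc (0 : ℝ) 1 :=
  ⟨Finset.prod_nonneg fun _ _ => (sinc_sq_mem_Icc _).1,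
    Finset.prod_le_one (fun _ _ => (sinc_sq_mem_Icc _).1) fun _ _ => (sinc_sq_mem_Icc _).2⟩

/-- ★★★ **THE HAAR FACTOR IS LIPSCHITZ ALONG (Dwhite)** — the (χ-Lip) certificate of RULING №57 (i): if the whitened coordinates move by
`‖W′ e − W e‖_∞ ≤ kW e·c` for every `e ∈ S` (the (Dwhite) letter, `c = ‖u‖`), then
`|Π_{e∈S} sinc²‖toE (W′ e)‖ − Π_{e∈S} sinc²‖toE (W e)‖| ≤ √3·(Σ_{e∈S} kW e)·c` — `Kχ := √3·Σ_{e∈S} kW e` (extensive in `#S`; harmless, REG′ is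
qualitative). [cite: Balaban1985UV3, p.260 L25-31 and (21) p.261] -/
theorem haarFactor_lip_of_dwhite {β : Type*} (S : Finset β) (W W' : β → Fin 3 → ℝ) (kW : β → ℝ) {c : ℝ}
    (hW : ∀ e ∈ S, ‖W' e - W e‖ ≤ kW e * c) :
    |(∏ e ∈ S, sinc ‖toE (W' e)‖ ^ 2) - ∏ e ∈ S, sinc ‖toE (W e)‖ ^ 2| ≤ Real.sqrt 3 * (∑ e ∈ S, kW e) * c := by
  have hfac : ∀ (X : β → Fin 3 → ℝ) (e : β), |sinc ‖toE (X e)‖ ^ 2| ≤ 1 := fun X e => by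
    rw [abs_of_nonneg (sinc_sq_mem_Icc _).1]; exact (sinc_sq_mem_Icc _).2
  calc |(∏ e ∈ S, sinc ‖toE (W' e)‖ ^ 2) - ∏ e ∈ S, sinc ‖toE (W e)‖ ^ 2|
      ≤ ∑ e ∈ S, |sinc ‖toE (W' e)‖ ^ 2 - sinc ‖toE (W e)‖ ^ 2| :=
        abs_prod_sub_prod_le_sum_abs S _ _ (fun e _ => hfac W' e) (fun e _ => hfac W e)
    _ ≤ ∑ e ∈ S, Real.sqrt 3 * (kW e * c) := Finset.sum_le_sum fun e he => by
        calc |sinc ‖toE (W' e)‖ ^ 2 - sinc ‖toE (W e)‖ ^ 2| ≤ |‖toE (W' e)‖ - ‖toE (W e)‖| := abs_sinc_sq_sub_sinc_sq_le _ _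
          _ ≤ ‖toE (W' e) - toE (W e)‖ := abs_norm_sub_norm_le _ _
          _ = ‖toE (W' e - W e)‖ := by rw [toE_sub]
          _ ≤ Real.sqrt 3 * ‖W' e - W e‖ :=
              norm_toE_le_of_mem_cube (mem_cube_iff.2 fun i => by rw [← Real.norm_eq_abs]; exact norm_le_pi_norm _ i)
          _ ≤ Real.sqrt 3 * (kW e * c) := mul_le_mul_of_nonneg_left (hW e he) (Real.sqrt_nonneg _)
    _ = Real.sqrt 3 * (∑ e ∈ S, kW e) * c := by rw [← Finset.mul_sum, ← Finset.sum_mul]; ring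

end Summit.QuantumFields.YangMills.Theorems.OrganTangentHaarFactorLipOfDwhite
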